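import Summits.CriticalPhenomena.PercolationContinuityZ3.Theses.PercNearOneGluing
import Literature.Probability.Percolation.PercolationEvents
import HarnessLib.Audit
import Literature.Probability.LatticeModels.ProdBernoulliIndependence
import Summits.CriticalPhenomena.PercolationContinuityZ3.Theorems.PercNearOneGluingAdditiveGluingOneBond
import Summits.CriticalPhenomena.PercolationContinuityZ3.Theorems.PercNearOneGluingAdditiveGluingKnLemma3Mixed
import Summits.CriticalPhenomena.PercolationContinuityZ3.Theorems.PercNearOneGluingNearOneGluingPivotalityDomination

/-! TTRL-lite variant V2460 of stmt-CriticalPhenomena-4574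

(`stub_shorteningStep` of line `kn_shortening_induction`, move `specialise+small_case`:
`n := 5` and `A.card ≤ 3`).  Kozma–Nitzan's SHORTENING STEP (arXiv:2401.12397, Conjecture 6,
p. 34) against the OLD minimiser `a₀`, on five vertices with at most three relays — proved outright
(the displayed induction hypothesis is not used).

Write `μ = prodBernoulli w`, `μ₁ = prodBernoulli (w[s(v,x) ↦ 1])`, `V = {v, x}`,
`{V ↔ z} = {v ↔ z} ∪ {x ↔ z}`, and pick relays `a₁, a₂` with `A ⊆ {a₀, a₁, a₂}`.
* Transport along `ω ↦ insert s(v,x) ω` (`goodStepEI_prodBernoulli_map_insert`,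
  `pivDom_reachable_insert`): `μ₁(v ↔ A) ≤ μ(E)`, `E = {V ↔ a₀} ∪ {V ↔ a₁} ∪ {V ↔ a₂}`;
  `μ₁(a₀ ↔ b) ≤ μ(K)`, `K = {a₀ ↔ b} ∪ ({a₀ ↔ v} ∩ {x ↔ b}) ∪ ({a₀ ↔ x} ∩ {v ↔ b})`;
  `μ(V ↔ b) ≤ μ₁(v ↔ b)`.
* Harris: `μ(E) μ(K) ≤ μ(E ∩ K)`, and
  `E ∩ K ⊆ ({V ↔ b} ∩ {a₀ ↔ V}) ∪ U`, `U = ({a₀ ↔ b} ∩ Q₁) ∪ ({a₀ ↔ b} ∩ Q₂)` with the mixed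
  set-observer events `Qᵢ = {V ↔ aᵢ} ∩ {V ↮ a₀}`.
* Kozma–Nitzan Lemma 3 (mixed form, `knLemma3Mixed_setObserver_star`, from
  van den Berg–Häggström–Kahn 2006 Thm 1.5) fed by the minimiser hypothesis
  `μ(a₀ ↔ b) ≤ μ(aᵢ ↔ b)`: `μ({a₀ ↔ b} ∩ Qᵢ) ≤ μ({V ↔ b} ∩ Qᵢ) ≤ μ({V ↔ b} ∖ {a₀ ↔ V})` for
  `i = 1, 2` separately.
* KEY (where `n = 5` enters): one of the two Lemma-3 bounds always suffices for `U`.  By pigeonhole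
  two of the six vertices `v, x, a₀, a₁, a₂, b ∈ Fin 5` coincide (`v ≠ x`, `v ∉ A`), and in each of
  the eleven coincidences either `{a₀ ↔ b} ∩ Q₂ ⊆ {a₀ ↔ b} ∩ Q₁` (e.g. `b = a₂`, `x = a₁`,
  `a₁ = a₂`, `b ∈ V`), or symmetrically `⊆ Q₂` (e.g. `b = a₁`), or `b = a₀`, where
  `{V ↔ b} ∖ {a₀ ↔ V} = ∅` kills both bounds.  (For six distinct vertices — general `n`, `|A| = 3`,
  `b ∉ A ∪ V` — one would need the two bounds jointly, which is Conjecture 6 itself.)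
Adding up, `μ₁(v ↔ A) μ₁(a₀ ↔ b) ≤ μ(E ∩ K) ≤ μ({V ↔ b} ∩ {a₀ ↔ V}) + μ({V ↔ b} ∖ {a₀ ↔ V})
= μ(V ↔ b) ≤ μ₁(v ↔ b)`.  No new definitions, no named facts. -/

namespace Summit.CriticalPhenomena.PercolationContinuityZ3.Theorems

open MeasureTheory Set Literature.Probability.LatticeModels Literature.Probability.Percolation
open scoped Classical BigOperators

/-- Pigeonhole absorption (pure graph combinatorics of one configuration `ω`).  In each of the seven
listed coincidences among `v, x, a₀, a₁, a₂, b`, a configuration in `{a₀ ↔ b} ∩ {V ↔ a₂} ∩ {V ↮ a₀}`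
(`V = {v, x}`) also lies in `{V ↔ a₁}` — or cannot exist at all. [folklore] -/
theorem stub_shorteningStep_var2460_absorb (ω : BondConfig (Fin 5)) {v x a₀ a₁ a₂ b : Fin 5}
    (hc : b = v ∨ b = x ∨ x = a₀ ∨ x = a₁ ∨ a₀ = a₂ ∨ a₁ = a₂ ∨ a₂ = b)
    (hab : (openGraph ω).Reachable a₀ b)
    (hy : ∃ y ∈ ({v, x} : Finset (Fin 5)), (openGraph ω).Reachable a₂ y)
    (hno : ∀ y ∈ ({v, x} : Finset (Fin 5)), ¬ (openGraph ω).Reachable a₀ y) :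
    ∃ y ∈ ({v, x} : Finset (Fin 5)), (openGraph ω).Reachable a₁ y := by
  rcases hc with rfl | rfl | rfl | rfl | rfl | rfl | rfl
  · exact absurd hab (hno _ (by simp))
  · exact absurd hab (hno _ (by simp))
  · exact absurd (SimpleGraph.Reachable.refl _) (hno _ (by simp))
  · exact ⟨_, by simp, SimpleGraph.Reachable.refl _⟩
  · obtain ⟨y, hy, hy'⟩ := hy
    exact absurd hy' (hno y hy)
  · exact hy
  · obtain ⟨y, hy, hy'⟩ := hy
    exact absurd (hab.trans hy') (hno y hy)

/-- When `b = a₀` the event `{V ↔ a₀} ∖ {a₀ ↔ V}` (`V = {v, x}`) is empty. [folklore] -/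
theorem stub_shorteningStep_var2460_diff_empty (v x a₀ : Fin 5) :
    ((openConn v a₀ ∪ openConn x a₀) \ (openConn a₀ v ∪ openConn a₀ x) :
      Set (BondConfig (Fin 5))) = ∅ := by
  ext ω
  simp only [Set.mem_sdiff, Set.mem_union, Set.mem_empty_iff_false, iff_false, not_and, not_not]
  rintro (h | h)
  exacts [Or.inl (SimpleGraph.Reachable.symm h), Or.inr (SimpleGraph.Reachable.symm h)]

/-- TTRL-lite variant V2460 of `stub_shorteningStep` (stmt-CriticalPhenomena-4574): Kozma–Nitzan's
shortening step (Conjecture 6 of arXiv:2401.12397, measured against the minimiser `a₀` of the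
uncontracted graph) on `Fin 5` with `A.card ≤ 3`.  Proof: transport the three glued probabilities
to the uncontracted measure along `ω ↦ insert s(v,x) ω`, Harris, and Kozma–Nitzan Lemma 3 for the
mixed-monotone set-observer events `{V ↔ aᵢ} ∩ {V ↮ a₀}` (`V = {v, x}`, `i = 1, 2`,
`knLemma3Mixed_setObserver_star`); on five vertices a pigeonhole coincidence among
`v, x, a₀, a₁, a₂, b` always lets ONE of the two Lemma-3 bounds absorb the other. -/
theorem stub_shorteningStep_var2460 : ∀ (w : Sym2 (Fin 5) → unitInterval) (A : Finset (Fin 5)) (b v x a₀ : Fin 5), A.card ≤ 3 → v ∉ A → v ≠ x → w s(v, x) = 0 → a₀ ∈ A → (∀ a ∈ A, (prodBernoulli w).real (openConn a₀ b) ≤ (prodBernoulli w).real (openConn a b)) → (∀ w' : Sym2 (Fin 5) → unitInterval, (∀ e, w e = 0 → w' e = 0) → ∀ (A' : Finset (Fin 5)) (o' b' : Fin 5) (t : ℝ), (∀ a ∈ A', t ≤ (prodBernoulli w').real (openConn a b')) → (prodBernoulli w').real (⋃ a ∈ A', openConn o' a) * t ≤ (prodBernoulli w').real (openConn o' b'))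 → (prodBernoulli (Function.update w s(v, x) 1)).real (⋃ a ∈ A, openConn v a) * (prodBernoulli (Function.update w s(v, x) 1)).real (openConn a₀ b) ≤ (prodBernoulli (Function.update w s(v, x) 1)).real (openConn v b) := by
  intro w A b v x a₀ hcard hvA hvx _hw0 ha₀ hmin _hIH
  -- two further relays `a₁ a₂ ∈ A` with `A ⊆ {a₀, a₁, a₂}` (repetitions allowed)
  obtain ⟨a₁, ha₁, a₂, ha₂, hA⟩ :
      ∃ a₁ ∈ A, ∃ a₂ ∈ A, ∀ a ∈ A, a = a₀ ∨ a = a₁ ∨ a = a₂ := by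
    by_cases h1 : ∃ a ∈ A, a ≠ a₀
    · obtain ⟨a₁, ha₁, h10⟩ := h1
      by_cases h2 : ∃ a ∈ A, a ≠ a₀ ∧ a ≠ a₁
      · obtain ⟨a₂, ha₂, h20, h21⟩ := h2
        refine ⟨a₁, ha₁, a₂, ha₂, fun a ha => ?_⟩
        by_contra hcon
        push Not at hcon
        obtain ⟨hc0, hc1, hc2⟩ := hcon
        have h3 : 2 < (A.erase a₀).card :=
          Finset.two_lt_card.2 ⟨a₁, Finset.mem_erase.2 ⟨h10, ha₁⟩, a₂,
            Finset.mem_erase.2 ⟨h20, ha₂⟩, a, Finset.mem_erase.2 ⟨hc0, ha⟩,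
            fun h => h21 h.symm, fun h => hc1 h.symm, fun h => hc2 h.symm⟩
        have h4 := Finset.card_erase_of_mem ha₀
        omega
      · push Not at h2
        refine ⟨a₁, ha₁, a₁, ha₁, fun a ha => ?_⟩
        by_cases h : a = a₀
        · exact Or.inl h
        · exact Or.inr (Or.inl (h2 a ha h))
    · push Not at h1
      exact ⟨a₀, ha₀, a₀, ha₀, fun a ha => Or.inl (h1 a ha)⟩
  -- every event is measurable on the finite configuration space
  have hmeas : ∀ S : Set (BondConfig (Fin 5)), MeasurableSet S := fun S =>
    MeasurableSet.of_discrete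
  -- transport along `ω ↦ insert s(v,x) ω`, whose image measure is the glued measure
  have hmi : Measurable fun ω : BondConfig (Fin 5) => insert s(v, x) ω := by
    refine measurable_set_iff.2 fun i => ?_
    simp only [Set.mem_insert_iff]
    exact measurable_const.or (measurable_set_mem i)
  have htrans : ∀ F : Set (BondConfig (Fin 5)),
      (prodBernoulli (Function.update w s(v, x) 1)).real F =
        (prodBernoulli w).real ((fun ω : BondConfig (Fin 5) => insert s(v, x) ω) ⁻¹' F) := by
    intro F
    rw [← goodStepEI_prodBernoulli_map_insert w s(v, x), map_measureReal_apply hmi (hmeas F)]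
  -- the events of the uncontracted graph (`V = {v, x}`)
  set Fb : Set (BondConfig (Fin 5)) := openConn v b ∪ openConn x b with hFb
  set E : Set (BondConfig (Fin 5)) :=
    (openConn v a₀ ∪ openConn x a₀) ∪
      ((openConn v a₁ ∪ openConn x a₁) ∪ (openConn v a₂ ∪ openConn x a₂)) with hE
  set K : Set (BondConfig (Fin 5)) :=
    openConn a₀ b ∪ ((openConn a₀ v ∩ openConn x b) ∪ (openConn a₀ x ∩ openConn v b)) with hK
  set T : Set (BondConfig (Fin 5)) := openConn a₀ v ∪ openConn a₀ x with hT
  set Q₁ : Set (BondConfig (Fin 5)) :=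
    {ω | (∃ y ∈ ({v, x} : Finset (Fin 5)), (openGraph ω).Reachable a₁ y) ∧
      ∀ y ∈ ({v, x} : Finset (Fin 5)), ¬ (openGraph ω).Reachable a₀ y} with hQ₁
  set Q₂ : Set (BondConfig (Fin 5)) :=
    {ω | (∃ y ∈ ({v, x} : Finset (Fin 5)), (openGraph ω).Reachable a₂ y) ∧
      ∀ y ∈ ({v, x} : Finset (Fin 5)), ¬ (openGraph ω).Reachable a₀ y} with hQ₂
  set U : Set (BondConfig (Fin 5)) := (openConn a₀ b ∩ Q₁) ∪ (openConn a₀ b ∩ Q₂) with hU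
  -- (1) the three transports
  have hX : (prodBernoulli w).real Fb ≤
      (prodBernoulli (Function.update w s(v, x) 1)).real (openConn v b) := by
    rw [htrans]
    refine measureReal_mono (fun ω hω => ?_)
    rcases hω with h | h
    · exact (h : (openGraph ω).Reachable v b).mono (openGraph_mono (Set.subset_insert _ _))
    · exact pivDom_reachable_insert_of ω hvx h
  have hY : (prodBernoulli (Function.update w s(v, x) 1)).real (⋃ a ∈ A, openConn v a) ≤
      (prodBernoulli w).real E := by
    rw [htrans]
    refine measureReal_mono (fun ω hω => ?_)
    simp only [Set.mem_preimage, Set.mem_iUnion, exists_prop] at hω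
    obtain ⟨a, ha, h⟩ := hω
    have h' : (openGraph ω).Reachable v a ∨ (openGraph ω).Reachable x a := by
      rcases pivDom_reachable_insert ω v x v a h with h1 | ⟨-, h1⟩ | ⟨-, h1⟩
      exacts [Or.inl h1, Or.inr h1, Or.inl h1]
    rcases hA a ha with h0 | h0 | h0
    · rw [h0] at h'
      exact Or.inl h'
    · rw [h0] at h'
      exact Or.inr (Or.inl h')
    · rw [h0] at h'
      exact Or.inr (Or.inr h')
  have hZ : (prodBernoulli (Function.update w s(v, x) 1)).real (openConn a₀ b) ≤
      (prodBernoulli w).real K := by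
    rw [htrans]
    refine measureReal_mono (fun ω hω => ?_)
    rcases pivDom_reachable_insert ω v x a₀ b hω with h1 | ⟨h1, h2⟩ | ⟨h1, h2⟩
    exacts [Or.inl h1, Or.inr (Or.inl ⟨h1, h2⟩), Or.inr (Or.inr ⟨h1, h2⟩)]
  -- (2) Harris for the increasing events `E`, `K`
  have hEup : IsUpperSet E :=
    ((isUpperSet_openConn v a₀).union (isUpperSet_openConn x a₀)).union
      (((isUpperSet_openConn v a₁).union (isUpperSet_openConn x a₁)).union
        ((isUpperSet_openConn v a₂).union (isUpperSet_openConn x a₂)))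
  have hKup : IsUpperSet K :=
    (isUpperSet_openConn a₀ b).union
      (((isUpperSet_openConn a₀ v).inter (isUpperSet_openConn x b)).union
        ((isUpperSet_openConn a₀ x).inter (isUpperSet_openConn v b)))
  have hHarris : (prodBernoulli w).real E * (prodBernoulli w).real K ≤
      (prodBernoulli w).real (E ∩ K) :=
    prodBernoulli_harris w hEup hKup (hmeas _) (hmeas _)
  -- (3) event algebra
  have hsplit : E ∩ K ⊆ (Fb ∩ T) ∪ U := by
    rintro ω ⟨hωE, hωK⟩
    by_cases hT' : ω ∈ T
    · left
      refine ⟨?_, hT'⟩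
      rcases hωK with hab | ⟨_, hxb⟩ | ⟨_, hvb⟩
      · rcases hT' with hav | hax
        · exact Or.inl ((SimpleGraph.Reachable.symm hav).trans hab)
        · exact Or.inr ((SimpleGraph.Reachable.symm hax).trans hab)
      · exact Or.inr hxb
      · exact Or.inl hvb
    · right
      have hav : ¬ (openGraph ω).Reachable a₀ v := fun h => hT' (Or.inl h)
      have hax : ¬ (openGraph ω).Reachable a₀ x := fun h => hT' (Or.inr h)
      have hab : ω ∈ (openConn a₀ b : Set (BondConfig (Fin 5))) := by
        rcases hωK with hab | ⟨h, _⟩ | ⟨h, _⟩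
        exacts [hab, absurd h hav, absurd h hax]
      have hno : ∀ y ∈ ({v, x} : Finset (Fin 5)), ¬ (openGraph ω).Reachable a₀ y := by
        intro y hy
        simp only [Finset.mem_insert, Finset.mem_singleton] at hy
        rcases hy with hy | hy
        · rw [hy]; exact hav
        · rw [hy]; exact hax
      rcases hωE with (h | h) | ((h | h) | (h | h))
      · exact absurd (SimpleGraph.Reachable.symm h) hav
      · exact absurd (SimpleGraph.Reachable.symm h) hax
      · exact Or.inl ⟨hab, ⟨v, by simp, SimpleGraph.Reachable.symm h⟩, hno⟩
      · exact Or.inl ⟨hab, ⟨x, by simp, SimpleGraph.Reachable.symm h⟩, hno⟩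
      · exact Or.inr ⟨hab, ⟨v, by simp, SimpleGraph.Reachable.symm h⟩, hno⟩
      · exact Or.inr ⟨hab, ⟨x, by simp, SimpleGraph.Reachable.symm h⟩, hno⟩
  -- (4) Kozma–Nitzan Lemma 3 (mixed, set observer `{v, x}`) for each relay, fed by the minimiser
  -- hypothesis, followed by `{V ↔ b} ∩ Qᵢ ⊆ {V ↔ b} ∖ {a₀ ↔ V}`
  have hpkg : ∀ a' ∈ A,
      (prodBernoulli w).real (openConn a₀ b ∩
        {ω | (∃ y ∈ ({v, x} : Finset (Fin 5)), (openGraph ω).Reachable a' y) ∧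
          ∀ y ∈ ({v, x} : Finset (Fin 5)), ¬ (openGraph ω).Reachable a₀ y}) ≤
      (prodBernoulli w).real (Fb \ T) := by
    intro a' ha'
    have hL3 := knLemma3Mixed_setObserver_star 5 w a₀ a' b ({v, x} : Finset (Fin 5)) 0 le_rfl
      (by rw [add_zero]; exact hmin a' ha')
    rw [add_zero] at hL3
    refine hL3.trans (measureReal_mono ?_)
    rintro ω ⟨⟨y, hy, hyb⟩, -, hno⟩
    refine ⟨?_, ?_⟩
    · simp only [Finset.mem_insert, Finset.mem_singleton] at hy
      rcases hy with hy | hy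
      · rw [hy] at hyb; exact Or.inl hyb
      · rw [hy] at hyb; exact Or.inr hyb
    · rintro (h | h)
      · exact hno v (by simp) h
      · exact hno x (by simp) h
  have hP₁ : (prodBernoulli w).real (openConn a₀ b ∩ Q₁) ≤ (prodBernoulli w).real (Fb \ T) :=
    hpkg a₁ ha₁
  have hP₂ : (prodBernoulli w).real (openConn a₀ b ∩ Q₂) ≤ (prodBernoulli w).real (Fb \ T) :=
    hpkg a₂ ha₂
  -- (5) KEY: on five vertices one of the two bounds absorbs the other (pigeonhole)
  have hKC : (prodBernoulli w).real U ≤ (prodBernoulli w).real (Fb \ T) := by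
    have hv0 : v ≠ a₀ := fun h => hvA (h ▸ ha₀)
    have hv1 : v ≠ a₁ := fun h => hvA (h ▸ ha₁)
    have hv2 : v ≠ a₂ := fun h => hvA (h ▸ ha₂)
    have hcases : (b = v ∨ b = x ∨ x = a₀ ∨ x = a₁ ∨ a₀ = a₂ ∨ a₁ = a₂ ∨ a₂ = b) ∨
        (x = a₂ ∨ a₀ = a₁ ∨ a₁ = b) ∨ a₀ = b := by
      have h1 := v.isLt
      have h2 := x.isLt
      have h3 := a₀.isLt
      have h4 := a₁.isLt
      have h5 := a₂.isLt
      have h6 := b.isLt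
      simp only [ne_eq, Fin.ext_iff] at hvx hv0 hv1 hv2 ⊢
      omega
    rcases hcases with hc | hc | hc
    · -- `{a₀ ↔ b} ∩ Q₂ ⊆ {a₀ ↔ b} ∩ Q₁`
      have hsub : openConn a₀ b ∩ Q₂ ⊆ openConn a₀ b ∩ Q₁ := by
        rintro ω ⟨hab, hy, hno⟩
        exact ⟨hab, stub_shorteningStep_var2460_absorb ω hc hab hy hno, hno⟩
      calc (prodBernoulli w).real U = (prodBernoulli w).real (openConn a₀ b ∩ Q₁) := by
            rw [hU, Set.union_eq_left.2 hsub]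
        _ ≤ (prodBernoulli w).real (Fb \ T) := hP₁
    · -- `{a₀ ↔ b} ∩ Q₁ ⊆ {a₀ ↔ b} ∩ Q₂`
      have hc' : b = v ∨ b = x ∨ x = a₀ ∨ x = a₂ ∨ a₀ = a₁ ∨ a₂ = a₁ ∨ a₁ = b := by
        rcases hc with h | h | h
        · exact Or.inr (Or.inr (Or.inr (Or.inl h)))
        · exact Or.inr (Or.inr (Or.inr (Or.inr (Or.inl h))))
        · exact Or.inr (Or.inr (Or.inr (Or.inr (Or.inr (Or.inr h)))))
      have hsub : openConn a₀ b ∩ Q₁ ⊆ openConn a₀ b ∩ Q₂ := by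
        rintro ω ⟨hab, hy, hno⟩
        exact ⟨hab, stub_shorteningStep_var2460_absorb ω hc' hab hy hno, hno⟩
      calc (prodBernoulli w).real U = (prodBernoulli w).real (openConn a₀ b ∩ Q₂) := by
            rw [hU, Set.union_eq_right.2 hsub]
        _ ≤ (prodBernoulli w).real (Fb \ T) := hP₂
    · -- `a₀ = b`: `{V ↔ b} ∖ {a₀ ↔ V} = ∅`, so both Lemma-3 bounds vanish
      have hFT : (prodBernoulli w).real (Fb \ T) = 0 := by
        rw [hFb, hT, ← hc, stub_shorteningStep_var2460_diff_empty, measureReal_empty]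
      have hUle : (prodBernoulli w).real U ≤
          (prodBernoulli w).real (openConn a₀ b ∩ Q₁) +
            (prodBernoulli w).real (openConn a₀ b ∩ Q₂) := by
        rw [hU]
        exact measureReal_union_le _ _
      linarith
  -- (6) assemble
  have hFsum : (prodBernoulli w).real (Fb ∩ T) + (prodBernoulli w).real (Fb \ T) =
      (prodBernoulli w).real Fb :=
    measureReal_inter_add_sdiff (hmeas T)
  have h1 : (prodBernoulli w).real (E ∩ K) ≤
      (prodBernoulli w).real (Fb ∩ T) + (prodBernoulli w).real U :=
    (measureReal_mono hsplit).trans (measureReal_union_le _ _)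
  calc (prodBernoulli (Function.update w s(v, x) 1)).real (⋃ a ∈ A, openConn v a) *
        (prodBernoulli (Function.update w s(v, x) 1)).real (openConn a₀ b)
      ≤ (prodBernoulli w).real E * (prodBernoulli w).real K :=
        mul_le_mul hY hZ measureReal_nonneg measureReal_nonneg
    _ ≤ (prodBernoulli w).real (E ∩ K) := hHarris
    _ ≤ (prodBernoulli w).real Fb := by linarith
    _ ≤ (prodBernoulli (Function.update w s(v, x) 1)).real (openConn v b) := hX

end Summit.CriticalPhenomena.PercolationContinuityZ3.Theorems
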